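import Summits.HodgeConjecture.CorCM.HypDel.M1primeOfFUPart5                             -- ★ W3 CLOSED: `stubW3 : ∀ g N δ, StubW3 g N δ` (σ-conjugate marked triples have σ-conjugate classifying points)
import Summits.HodgeConjecture.CorCM.HypDel.M1primeOfFUPart3                             -- ★ (T2) `translateRightT` / `MarkedBy.translateRight`
import Summits.HodgeConjecture.CorCM.HypDel.M1primeOfFUPart6                             -- ★ `isAdmissibleAt_iff_markedBy` (`Iff.rfl`)
import Literature.AlgebraicGeometry.Motives.AbelianVarietyConjugateComp                     -- ★ `AbelianVariety.exists_iso_conjugate_refl` (`A^{id} ≅ A`, `x^{id} ↦ x`)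
import Literature.AlgebraicGeometry.ModuliOfAbelianVarieties.SiegelModuliComplexUniformisation   -- ★ (U) `IsAdmissibleAt`, `SiegelFineModuliScheme`, `classifyingMap`
import HarnessLib

/-!
# Two triples admissible at the same `(Z, r)` have the same classifying map (node U-c (ii) / U-e socket P6)

Cell hodgecm-mathlib, (U)-HEAD second layer (B-plan2 (g10) 13:33:02Z / 13:37:04Z; hand A-p06 (g12)): the statement of B-typ02
(g11)'s socket `UHead.Ue_P6_classify_eq_of_isAdmissibleAt` ((U)-HEAD skeleton v0.10), proved.  THEOREMS ONLY; no definition, no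
named fact, no instance, no `sorry`.  HC_CM is proved only modulo the printed citations until rung 0 closes.

ROAD: the `σ = 1` SPECIALISATION of the tree's CLOSED W3 assembly ★ `Summit.HodgeConjecture.CorCM.HypDel.M1primeOfFU.stubW3`
([Milne 2005] Prop. 14.12 / Thm. 6.11 on points: for `σ : ℂ ≃ₐ[ℚ] ℂ`, markings `m` of `A` by `[J, a]` and `m′` of `A′` by
`[J′, a′]`, an `f : A^σ ⟶ A′` reading the markings, and triples `P′`, `P″` over `Spec ℂ` marked by `[J, a]`, `[J′, a′]`:
`σ • classifyingMap P′ = classifyingMap P″`) at `σ := 1`, `J′ := J`, `a′ := a`, `A′ := A :=` the fibre of `P′` with its own marking,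
`f := e_A : A^{id} ≅ A` (★ `AbelianVariety.exists_iso_conjugate_refl`, `e_A(x^{id}) = x`), `k := 1` (the antecedent is then
`a⁻¹(v̂ − ŵ)` integral `⇒ m.r v = m.r w`, ★ `SiegelAdelicMarking.r_eq_of_forall_mem`), and `1 • x = x`
(★ `AlgPoints.instMulActionAlgEquiv`); ★ (U) `IsAdmissibleAt hδ r Z hZ P′` IS ★ W0 `MarkedBy [J(Z)] r P′`
(★ `isAdmissibleAt_iff_markedBy`, `Iff.rfl`).  Variants: along an equality of Shimura-set classes (★ `MarkedBy.transport`) and the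
TWO-REPRESENTATIVE form `r⁻¹ r′ ∈ K_δ(N)` (★ (T2) `MarkedBy.translateRight`).

* `SiegelAdelicMarking.r_eq_of_adelicCongr_one_mul` — the `k = 1`, `σ = 1` reading clause.
* `classifyingMap_eq_of_markedBy` — U-c (ii) in `MarkedBy` currency, any point `[J, a]`.
* `classifyingMap_eq_of_markedBy_of_mk_eq` — along `[J, aK_δ(N)] = [J′, a′K_δ(N)]`.
* `classifyingMap_eq_of_isAdmissibleAt_of_inv_mul_mem` — two representatives `r`, `r′` with `r⁻¹ r′ ∈ K_δ(N)`.
* `classifyingMap_eq_of_isAdmissibleAt` — the socket text `Ue_P6_classify_eq_of_isAdmissibleAt` VERBATIM as a theorem.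

## References
* [Milne2005ShimuraVarieties] J. S. Milne, *Introduction to Shimura varieties* (2005), §5 p. 57, Lemma 5.13 p. 57, §6 Thm. 6.11
  pp. 74–75, §14 Prop. 14.12 p. 125.
* [Deligne1971TravauxShimura] P. Deligne, *Travaux de Shimura*, Sém. Bourbaki 389 (1971), 4.11–4.12 pp. 148–149.
* [MumfordFogartyKirwan1994] D. Mumford, J. Fogarty, F. Kirwan, *Geometric Invariant Theory*, 3rd ed. (1994), Ch. 7 §3 Thm. 7.9 p. 139.
-/

set_option autoImplicit false

noncomputable section

open CategoryTheory CategoryTheory.Limits AlgebraicGeometry Matrix Topology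
open Literature.AlgebraicGeometry.Motives (SchemeOver ComplexPoints AlgPoints specOver AbelianVariety CartierDivisor)
open Literature.AlgebraicGeometry.AbelianSchemes (PolarizedAbelianSchemeWithLevel AbelianSchemeOver)
open Literature.NumberTheory.Automorphic (siegelUpperHalfSpace)
open Literature.AlgebraicGeometry.ModuliOfAbelianVarieties

namespace Summit.HodgeConjecture.CorCM.HypDel.UHead

/-! ## §1 The `σ = 1`, `k = 1` reading of a marking, and U-c (ii) in `MarkedBy` currency -/

open Summit.HodgeConjecture.CorCM.HypDel.M1primeOfFU (MarkedBy StubW3 stubW3 isAdmissibleAt_iff_markedBy translateRightT)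
open SiegelModuli (jOfSiegel)

variable {g N : ℕ} {δ : Fin g → ℕ}

/-- **The `k = 1`, `σ = 1` antecedent of W3**: if `(1·a⁻¹) v̂ − a⁻¹ ŵ` is integral then the marking reads `v` and `w` alike,
`m.r v = m.r w` (★ `SiegelAdelicMarking.r_eq_of_forall_mem`). [cite: Milne2005ShimuraVarieties, §6 Thm. 6.11 p. 74] -/
theorem SiegelAdelicMarking.r_eq_of_adelicCongr_one_mul {J : C0pm δ} {a : gspFinAdelic δ} {A : AbelianVariety ℂ}
    (m : SiegelAdelicMarking J a A) {v w : Fin g ⊕ Fin g → ℚ}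
    (h : AdelicCongr ((1 * a⁻¹ : gspFinAdelic δ) : GL (Fin g ⊕ Fin g) finAdeleQ)
      ((a⁻¹ : gspFinAdelic δ) : GL (Fin g ⊕ Fin g) finAdeleQ) v w) :
    m.r v = m.r w := by
  refine m.r_eq_of_forall_mem fun i => ?_
  have hi := h i
  rw [one_mul, ← Matrix.mulVec_sub] at hi
  rwa [adelicVec_sub]

/-- **Node U-c (ii) in `MarkedBy` currency: two triples over `Spec ℂ` marked by the SAME point `[J, a]` have the same classifying
map** — ★ W3 `stubW3` at `σ = 1` with `f := e_A : A^{id} ≅ A` (★ `exists_iso_conjugate_refl`) and `k := 1`.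
[cite: Milne2005ShimuraVarieties, §6 Thm. 6.11 pp. 74–75 and §14 Prop. 14.12 p. 125] -/
theorem classifyingMap_eq_of_markedBy (hg : 0 < g) (hδ : IsPolarizationType δ) (hN : 3 ≤ N)
    (𝓜 : SiegelFineModuliScheme g N δ) (J : C0pm δ) (a : gspFinAdelic δ)
    (P' P'' : PolarizedAbelianSchemeWithLevel g N δ (specOver ℚ ℂ).left) (hP' : MarkedBy J a P') (hP'' : MarkedBy J a P'') :
    haveI : IsLocallyNoetherian (specOver ℚ ℂ).left := inferInstanceAs (IsLocallyNoetherian (Spec (CommRingCat.of ℂ)))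
    𝓜.classifyingMap (specOver ℚ ℂ) P' = 𝓜.classifyingMap (specOver ℚ ℂ) P'' := by
  obtain ⟨m, Θ, Λ, hamp, hlam, htower⟩ := hP'
  obtain ⟨e, -, he, -⟩ := AbelianVariety.exists_iso_conjugate_refl (L := ℂ)
  have hW := stubW3 g N δ hg hδ hN 𝓜 1 J J a a _ _ m m (e _).hom
    ⟨1, Subgroup.one_mem _, fun v w hvw => by
      rw [SiegelAdelicMarking.r_eq_of_adelicCongr_one_mul m hvw]
      exact he _ (m.r w)⟩
    P' P'' ⟨m, Θ, Λ, hamp, hlam, htower⟩ hP''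
  rwa [one_smul] at hW

/-- **U-c (ii) along an equality of Shimura-set classes**: if `P′` is marked by `(J, a)`, `P″` by `(J′, a′)` and
`[J, a K_δ(N)] = [J′, a′ K_δ(N)]`, then `classifyingMap P′ = classifyingMap P″` (★ `MarkedBy.transport` with (T2) ★ `translateRightT`,
then `classifyingMap_eq_of_markedBy`). [cite: Milne2005ShimuraVarieties, §5 p. 57, §6 Thm. 6.11 pp. 74–75] -/
theorem classifyingMap_eq_of_markedBy_of_mk_eq (hg : 0 < g) (hδ : IsPolarizationType δ) (hN : 3 ≤ N)
    (𝓜 : SiegelFineModuliScheme g N δ) {J J' : C0pm δ} {a a' : gspFinAdelic δ}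
    (P' P'' : PolarizedAbelianSchemeWithLevel g N δ (specOver ℚ ℂ).left) (hP' : MarkedBy J a P') (hP'' : MarkedBy J' a' P'')
    (heq : SiegelShimuraSet.mk δ (principalLevelSubgroup δ N) J a = SiegelShimuraSet.mk δ (principalLevelSubgroup δ N) J' a') :
    haveI : IsLocallyNoetherian (specOver ℚ ℂ).left := inferInstanceAs (IsLocallyNoetherian (Spec (CommRingCat.of ℂ)))
    𝓜.classifyingMap (specOver ℚ ℂ) P' = 𝓜.classifyingMap (specOver ℚ ℂ) P'' :=
  classifyingMap_eq_of_markedBy hg hδ hN 𝓜 J' a' P' P'' (hP'.transport translateRightT heq) hP''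

/-- **U-c (ii), TWO-REPRESENTATIVE form**: `P′` admissible at `(Z, r)` and `P″` admissible at `(Z, r′)` with `r⁻¹ r′ ∈ K_δ(N)` (two
principal representatives of the same residue, L2) have the same classifying map (★ (T2) `MarkedBy.translateRight` with
`k := r⁻¹ r′`, then `classifyingMap_eq_of_markedBy` at `(J(Z), r′)`). [cite: Milne2005ShimuraVarieties, §6 Thm. 6.11 pp. 74–75, §5 Lemma 5.13 p. 57] -/
theorem classifyingMap_eq_of_isAdmissibleAt_of_inv_mul_mem (hg : 0 < g) (hδ : IsPolarizationType δ) (hN : 3 ≤ N)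
    (𝓜 : SiegelFineModuliScheme g N δ) {r r' : gspFinAdelic δ} (hrr' : r⁻¹ * r' ∈ principalLevelSubgroup δ N)
    (Z : Matrix (Fin g) (Fin g) ℂ) (hZ : Z ∈ siegelUpperHalfSpace g)
    (P' P'' : PolarizedAbelianSchemeWithLevel g N δ (specOver ℚ ℂ).left)
    (hP' : IsAdmissibleAt hδ r Z hZ P') (hP'' : IsAdmissibleAt hδ r' Z hZ P'') :
    haveI : IsLocallyNoetherian (specOver ℚ ℂ).left := inferInstanceAs (IsLocallyNoetherian (Spec (CommRingCat.of ℂ)))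
    𝓜.classifyingMap (specOver ℚ ℂ) P' = 𝓜.classifyingMap (specOver ℚ ℂ) P'' := by
  have h₁ : MarkedBy ⟨jOfSiegel δ Z, SiegelComplexRecordSystem.jOfSiegel_mem_C0pm hδ.1 hZ⟩ r' P' := by
    have h := (MarkedBy.translateRight hrr' ((isAdmissibleAt_iff_markedBy hδ r Z hZ P').1 hP'))
    rwa [mul_inv_cancel_left] at h
  exact classifyingMap_eq_of_markedBy hg hδ hN 𝓜 _ r' P' P'' h₁ ((isAdmissibleAt_iff_markedBy hδ r' Z hZ P'').1 hP'')

/-! ## §2 The socket text of the (U)-HEAD, as a theorem -/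

/-- **U-e P6 = U-c (ii): two triples over `Spec ℂ` admissible at the same `(Z, r)` have the same classifying map** — the text of
B-typ02's (U)-HEAD socket `UHead.Ue_P6_classify_eq_of_isAdmissibleAt` VERBATIM (binder for binder), so the skeleton closes its stub by
this name. [cite: Milne2005ShimuraVarieties, §6 Thm. 6.11 pp. 74–75 and Lemma 5.13 p. 57]
[cite: Deligne1971TravauxShimura, 4.11–4.12 pp. 148–149] [cite: MumfordFogartyKirwan1994, Ch. 7 §3 Theorem 7.9 (p. 139)] -/
theorem classifyingMap_eq_of_isAdmissibleAt :
    ∀ (g N : ℕ) (δ : Fin g → ℕ) (_hg : 0 < g) (hδ : IsPolarizationType δ) (_hN : 3 ≤ N)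
      (𝓜 : SiegelFineModuliScheme g N δ) (r : gspFinAdelic δ),
      haveI : IsLocallyNoetherian (specOver ℚ ℂ).left :=
        inferInstanceAs (IsLocallyNoetherian (Spec (CommRingCat.of ℂ)))
      r ∈ principalLevelSubgroup δ 1 →
      ∀ (Z : Matrix (Fin g) (Fin g) ℂ) (hZ : Z ∈ siegelUpperHalfSpace g)
        (P' P'' : PolarizedAbelianSchemeWithLevel g N δ (specOver ℚ ℂ).left),
        IsAdmissibleAt hδ r Z hZ P' → IsAdmissibleAt hδ r Z hZ P'' →
          𝓜.classifyingMap (specOver ℚ ℂ) P' = 𝓜.classifyingMap (specOver ℚ ℂ) P'' := by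
  intro g N δ hg hδ hN 𝓜 r _hr Z hZ P' P'' hP' hP''
  exact classifyingMap_eq_of_markedBy hg hδ hN 𝓜 _ r P' P'' ((isAdmissibleAt_iff_markedBy hδ r Z hZ P').1 hP')
    ((isAdmissibleAt_iff_markedBy hδ r Z hZ P'').1 hP'')

end Summit.HodgeConjecture.CorCM.HypDel.UHead

end
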